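import Summits.CriticalPhenomena.SAWScalingLimit.Theorems.SAWLoopFugacityFlowAvoidanceLimitAnchorDefs
import Literature.Probability.LatticeModels.MeshDomainBigComponents
import Literature.Probability.LatticeModels.MeshDomainBulk
import Literature.Probability.LatticeModels.WeakBeurlingEstimate
import Literature.Probability.LatticeModels.PlanarIsing

/-!
# Lattice boxes deep inside the domain are full in `Ω_δ`
— UBHP brick B-box of line `symplectic-fermion-anchor`
(crux `SAWLoopFugacityFlow.AvoidanceLimit`, stmt-CriticalPhenomena-10649; lead c3)

The uniform boundary Harnack principle `stub_uniformBHP` of the line concerns functions on the volume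
`Λ = meshDomainFinset Ω δ` that are harmonic for the EDGE-killed simple random walk of the discrete
domain `Ω_δ = discreteDomainGraph Ω δ`. In the bulk of the domain this walk is the full simple random
walk of `ℤ²`; the present file records the precise statement used by the interior Harnack brick:

* `discreteDomainGraph_full_on_box` (registered signature) — if `v ∈ meshDomain Ω δ` and every site
  `x` of the lattice box `sqBox v (n + 1)` has `closedBall (δ x) δ ⊆ Ω`, then every site of
  `sqBox v n` lies in `meshDomainFinset Ω δ`, and so does each of its four lattice neighbours `y`,
  with `x ∼ y` an edge of `Ω_δ`.

Proof. The closed rectangle spanned by the mesh points of two sites `a`, `b` of the big box lies in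
`Ω`: each of its points is within `δ` of the mesh point of its nearest site
(`dist_meshPoint_nearestSite_le`), and that site lies coordinatewise between `a` and `b` (rounding is
monotone and fixes integers), hence in the box. So every site of the big box is joined to `v` inside
the mesh graph on mesh vertices by the staircase lemma
`meshVertexGraph_reachable_of_rectangle_subset`, hence lies in `meshDomain Ω δ`
(`mem_meshDomain_of_reachable_meshVertexGraph`); and the closed mesh edge `[δ x, δ y]` of two
lattice neighbours of the big box lies in their (degenerate) rectangle, inside `Ω ⊆ Ω̄`, which is
mesh adjacency (`meshGraph_adj_iff`) and then `Ω_δ`-adjacency (`discreteDomainGraph_adj_iff`).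
Sources: folklore. No definitions.
-/

noncomputable section

open scoped BigOperators Classical
open Finset
open Literature.Probability.RandomPlanarGeometry Literature.Probability.LatticeModels

namespace Summit.CriticalPhenomena.SAWScalingLimit.Theorems.AvoidanceLimit.Anchor

/-- Rounding to the nearest integer is monotone. [folklore] -/
theorem round_le_round_of_le {s t : ℝ} (h : s ≤ t) : round s ≤ round t := by
  rw [round_eq, round_eq]
  exact Int.floor_le_floor (by linarith)

/-- Rounding a real number lying between two integers gives an integer between them (rounding is
monotone and fixes integers). [folklore] -/
theorem round_mem_uIcc_of_mem_uIcc {a b : ℤ} {t : ℝ} (h : t ∈ Set.uIcc (a : ℝ) (b : ℝ)) :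
    round t ∈ Set.uIcc a b := by
  have ha : round (a : ℝ) = a := round_intCast a
  have hb : round (b : ℝ) = b := round_intCast b
  rcases Set.mem_uIcc.1 h with ⟨h1, h2⟩ | ⟨h1, h2⟩
  · exact Set.mem_uIcc.2 (Or.inl ⟨ha ▸ round_le_round_of_le h1, hb ▸ round_le_round_of_le h2⟩)
  · exact Set.mem_uIcc.2 (Or.inr ⟨hb ▸ round_le_round_of_le h1, ha ▸ round_le_round_of_le h2⟩)

/-- Dividing by the positive mesh maps `[[δ m, δ k]]` into `[[m, k]]`. [folklore] -/
theorem div_mem_uIcc_of_mem_uIcc {δ : ℝ} (hδ : 0 < δ) {q : ℝ} {m k : ℤ}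
    (hq : q ∈ Set.uIcc (δ * (m : ℝ)) (δ * (k : ℝ))) :
    q / δ ∈ Set.uIcc (m : ℝ) (k : ℝ) := by
  have hm : δ * (m : ℝ) / δ = m := mul_div_cancel_left₀ _ hδ.ne'
  have hk : δ * (k : ℝ) / δ = k := mul_div_cancel_left₀ _ hδ.ne'
  rcases Set.mem_uIcc.1 hq with ⟨h1, h2⟩ | ⟨h1, h2⟩
  · exact Set.mem_uIcc.2 (Or.inl ⟨hm ▸ div_le_div_of_nonneg_right h1 hδ.le,
      hk ▸ div_le_div_of_nonneg_right h2 hδ.le⟩)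
  · exact Set.mem_uIcc.2 (Or.inr ⟨hk ▸ div_le_div_of_nonneg_right h1 hδ.le,
      hm ▸ div_le_div_of_nonneg_right h2 hδ.le⟩)

/-- The site nearest to a point of the closed rectangle spanned by the mesh points of two sites
`a`, `b` lies coordinatewise between `a` and `b`. [folklore] -/
theorem nearestSite_mem_uIcc_of_mem_rectangle {δ : ℝ} (hδ : 0 < δ) {a b : Site 2} {p : ℂ}
    (hp : p ∈ Complex.Rectangle (meshPoint δ a) (meshPoint δ b)) (j : Fin 2) :
    nearestSite δ p j ∈ Set.uIcc (a j) (b j) := by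
  obtain ⟨hre, him⟩ := hp
  rw [meshPoint_re, meshPoint_re] at hre
  rw [meshPoint_im, meshPoint_im] at him
  fin_cases j
  · simpa [nearestSite] using round_mem_uIcc_of_mem_uIcc (div_mem_uIcc_of_mem_uIcc hδ hre)
  · simpa [nearestSite] using round_mem_uIcc_of_mem_uIcc (div_mem_uIcc_of_mem_uIcc hδ him)

/-- If the closed `δ`-balls about the mesh points of all sites lying coordinatewise between `a` and
`b` are contained in `Ω`, then so is the closed rectangle spanned by the mesh points of `a` and `b`:
every point of the rectangle is within `δ` of the mesh point of its nearest site. [folklore] -/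
theorem rectangle_meshPoint_subset_of_closedBall_subset {Ω : Set ℂ} {δ : ℝ} (hδ : 0 < δ)
    {a b : Site 2}
    (h : ∀ w : Site 2, (∀ j, w j ∈ Set.uIcc (a j) (b j)) →
      Metric.closedBall (meshPoint δ w) δ ⊆ Ω) :
    Complex.Rectangle (meshPoint δ a) (meshPoint δ b) ⊆ Ω := by
  intro p hp
  refine h (nearestSite δ p) (nearestSite_mem_uIcc_of_mem_rectangle hδ hp) ?_
  rw [Metric.mem_closedBall, dist_comm]
  exact dist_meshPoint_nearestSite_le hδ p

/-- Lattice boxes are coordinatewise convex: a site lying coordinatewise between two sites of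
`sqBox v m` lies in `sqBox v m`. [folklore] -/
theorem mem_sqBox_of_forall_mem_uIcc {v a b w : Site 2} {m : ℤ}
    (ha : a ∈ WeakBeurling.sqBox v m) (hb : b ∈ WeakBeurling.sqBox v m)
    (hw : ∀ j, w j ∈ Set.uIcc (a j) (b j)) : w ∈ WeakBeurling.sqBox v m := by
  rw [WeakBeurling.mem_sqBox, abs_le, abs_le] at ha hb ⊢
  have h0 := hw 0
  have h1 := hw 1
  rw [Set.mem_uIcc] at h0 h1
  omega

/-- **Lattice boxes deep inside the domain are full in `Ω_δ`** (registered signature, UBHP brick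
B-box). If `v ∈ meshDomain Ω δ` and every site of `sqBox v (n + 1)` has its closed `δ`-ball about its
mesh point inside `Ω`, then every site `x ∈ sqBox v n` lies in `meshDomainFinset Ω δ`, and each lattice
neighbour `y` of `x` lies in `meshDomainFinset Ω δ` with `(discreteDomainGraph Ω δ).Adj x y`: the rectangle
spanned by two sites of the big box lies in `Ω`, so the staircase lemma joins every site of the big box
to `v`, and the closed mesh edge `[δ x, δ y]` lies in `Ω ⊆ Ω̄`. [folklore] -/
theorem discreteDomainGraph_full_on_box :
    ∀ (Ω : Set ℂ), Bornology.IsBounded Ω → ∀ (δ : ℝ), 0 < δ → ∀ (v : Site 2) (n : ℕ), v ∈ meshDomain Ω δ → (∀ x ∈ WeakBeurling.sqBox v (n + 1), Metric.closedBall (meshPoint δ x) δ ⊆ Ω) → ∀ x ∈ WeakBeurling.sqBox v n, x ∈ meshDomainFinset Ω δ ∧ ∀ y : Site 2, (zdGraph 2).Adj x y → y ∈ meshDomainFinset Ω δ ∧ (discreteDomainGraph Ω δ).Adj x y := by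
  intro Ω hΩ δ hδ v n hv hball x hx
  -- the centre lies in the big box
  have hvbox : v ∈ WeakBeurling.sqBox v (n + 1) := by
    rw [WeakBeurling.mem_sqBox, sub_self, sub_self, abs_zero]
    constructor <;> positivity
  -- the closed rectangle spanned by two sites of the big box lies in `Ω`
  have hrect : ∀ a ∈ WeakBeurling.sqBox v (n + 1), ∀ b ∈ WeakBeurling.sqBox v (n + 1),
      Complex.Rectangle (meshPoint δ a) (meshPoint δ b) ⊆ Ω := fun a ha b hb =>
    rectangle_meshPoint_subset_of_closedBall_subset hδ fun w hw =>
      hball w (mem_sqBox_of_forall_mem_uIcc ha hb hw)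
  -- every site of the big box is a vertex of `Ω_δ` (staircase to the centre)
  have hdom : ∀ y ∈ WeakBeurling.sqBox v (n + 1), y ∈ meshDomain Ω δ := by
    intro y hy
    have hR := hrect v hvbox y hy
    have hvV : v ∈ meshVertices Ω δ := hR (left_mem_rectangle _ _)
    have hyV : y ∈ meshVertices Ω δ := hR (right_mem_rectangle _ _)
    exact mem_meshDomain_of_reachable_meshVertexGraph hv hvV hyV
      (meshVertexGraph_reachable_of_rectangle_subset hδ _ v y rfl hR hvV hyV)
  have hfin : ∀ y ∈ WeakBeurling.sqBox v (n + 1), y ∈ meshDomainFinset Ω δ := fun y hy => by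
    rw [← Finset.mem_coe, coe_meshDomainFinset hΩ hδ]
    exact hdom y hy
  have hx' : x ∈ WeakBeurling.sqBox v (n + 1) :=
    WeakBeurling.sqBox_mono v (by omega) hx
  refine ⟨hfin x hx', fun y hxy => ?_⟩
  have hy' : y ∈ WeakBeurling.sqBox v (n + 1) := WeakBeurling.mem_sqBox_succ_of_adj hx hxy
  refine ⟨hfin y hy', discreteDomainGraph_adj_iff.2 ⟨?_, hdom x hx', hdom y hy'⟩⟩
  -- the closed mesh edge lies in the (degenerate) rectangle of its endpoints, inside `Ω ⊆ Ω̄`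
  refine meshGraph_adj_iff.2 ⟨hxy, ?_⟩
  exact ((convex_rectangle _ _).segment_subset (left_mem_rectangle _ _)
    (right_mem_rectangle _ _)).trans ((hrect x hx' y hy').trans subset_closure)

end Summit.CriticalPhenomena.SAWScalingLimit.Theorems.AvoidanceLimit.Anchor

end
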